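import Literature.NumberTheory.GaloisRepresentations.GlobalReciprocityProofs
import Literature.NumberTheory.Automorphic.IdeleClassGroupDivisibleProofs
import HarnessLib

/-!
# The global reciprocity law is equivalent to the Artin map in limit form (`K : Type`)

Topic `NumberTheory/GaloisRepresentations`; namespace `Literature.NumberTheory.GaloisRepresentations`.
Third proof file of `GlobalReciprocity.lean` (after `GlobalReciprocityProofs.lean`), closing the
topological half of Neukirch's proof of Part III Thm. (7.12) of *Class Field Theory — The Bonn
Lectures*.

`GlobalReciprocityProofs` proves "(7.12) from its inputs": a continuous `θ : C_K →* Γ_K^ab` with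
dense range such that (a) every open finite-index subgroup of `C_K` is some `θ⁻¹(H)` (`H` open;
Artin reciprocity (6.13), (6.14) and the existence theorem (7.8), in limit form) and (b) the
classes lying in every open finite-index subgroup are infinitely divisible (first half of the
proof of (7.12)) is a global reciprocity map (`IsGlobalReciprocityMap.of_denseRange₀`).  Input
(b) is a statement about the topological group `C_K` alone, and it is now a **theorem** of the
tree for `K : Type`: `Automorphic.IdeleClassGroup.forall_exists_pow_eq_of_forall_mem`
(`Automorphic/IdeleClassGroupDivisibleProofs.lean` — Neukirch's argument run with the open
finite-index subgroups `C_Kⁿ · W̄(𝔫)` supplied by the compactness of `C_K¹`).  Hence: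

* `IsGlobalReciprocityMap.of_denseRange₁`, `isGlobalReciprocityMap_iff_denseRange₁` — `θ` is a
  global reciprocity map iff it is continuous with dense range and satisfies (a);
* `exists_isGlobalReciprocityMap_iff_artinMapLimitForm` — **the named fact
  `exists_isGlobalReciprocityMap K` is equivalent to (a) alone**: the existence of a continuous
  `θ : C_K →* Γ_K^ab` with dense range pulling the open subgroups of `Γ_K^ab` back onto all open
  subgroups of finite index of `C_K`.  What remains between the tree and the global reciprocity
  law is therefore global class field theory proper (cohomology of the idele class group, first
  and second inequalities, the invariant map / class formation (6.8)–(6.9), Kummer theory (7.7),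
  and the passage to the limit II (1.15)), and nothing topological.

`K : Type` (universe `0`) because the idele class group API of `Automorphic/IdeleClassGroup`
(`posRealIdele`, `AdelicGroupData`) is universe `0`; the universe-polymorphic named fact keeps the
decomposition `C_K = (compact) · (divisible)` and (b) as hypotheses
(`exists_isGlobalReciprocityMap_of'`, `IsGlobalReciprocityMap.of_denseRange`).

## References

* J. Neukirch, *Class Field Theory — The Bonn Lectures* (ed. A. Schmidt), Springer 2013, Part III
  §6 (6.13), (6.14), p. 169–170; §7 (7.4), (7.6), (7.8), Thm. (7.12) and its proof
  (p. 182–183); Part II (1.15). [Neukirch2013]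
-/

noncomputable section

open NumberField Field Topology

namespace Literature.NumberTheory.GaloisRepresentations

variable {K : Type} [Field K] [NumberField K]

/-- **Neukirch III (7.12) from the Artin map in limit form** (`K : Type`): a continuous
homomorphism `θ : C_K →* Γ_K^ab` with dense range such that every open subgroup of finite index
of `C_K` is `θ⁻¹(H)` for an open `H ≤ Γ_K^ab` (Artin reciprocity (6.13), (6.14) with the
existence theorem (7.8), in limit form) **is a global reciprocity map**: surjective, with kernel
the infinitely divisible classes.  Both topological inputs of Neukirch's proof are theorems of
the tree: `C_K = C_K¹ · ℝ₊ˣ` with `C_K¹` compact ((7.4), (7.6):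
`Automorphic.IdeleClassGroup.exists_isCompact_mul_divisible`) and "a class in every open
finite-index subgroup is infinitely divisible" ((7.12), first half of the proof:
`Automorphic.IdeleClassGroup.forall_exists_pow_eq_of_forall_mem`).
[cite: Neukirch2013, Part III Thm. (7.12) (proof, p. 182–183)] -/
theorem IsGlobalReciprocityMap.of_denseRange₁
    {θ : ideleGroup K ⧸ principalIdeles K →* absoluteGaloisGroupAbelianization K}
    (hcont : Continuous θ) (hdense : DenseRange θ)
    (hexist : ∀ N : Subgroup (ideleGroup K ⧸ principalIdeles K),
      IsOpen (N : Set (ideleGroup K ⧸ principalIdeles K)) → N.FiniteIndex →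
        ∃ H : Subgroup (absoluteGaloisGroupAbelianization K),
          IsOpen (H : Set (absoluteGaloisGroupAbelianization K)) ∧ H.comap θ = N) :
    IsGlobalReciprocityMap K θ :=
  IsGlobalReciprocityMap.of_denseRange₀ hcont hdense hexist fun _ ha _ hn =>
    Automorphic.IdeleClassGroup.forall_exists_pow_eq_of_forall_mem K ha hn

/-- **`IsGlobalReciprocityMap` = "continuous, dense range, existence theorem"** (`K : Type`):
`θ : C_K →* Γ_K^ab` is a global reciprocity map iff it is continuous with dense range and every
open finite-index subgroup of `C_K` is some `θ⁻¹(H)` with `H` open.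
[cite: Neukirch2013, Part III Thm. (7.12)] -/
theorem isGlobalReciprocityMap_iff_denseRange₁
    (θ : ideleGroup K ⧸ principalIdeles K →* absoluteGaloisGroupAbelianization K) :
    IsGlobalReciprocityMap K θ ↔
      Continuous θ ∧ DenseRange θ ∧
      ∀ N : Subgroup (ideleGroup K ⧸ principalIdeles K),
        IsOpen (N : Set (ideleGroup K ⧸ principalIdeles K)) → N.FiniteIndex →
          ∃ H : Subgroup (absoluteGaloisGroupAbelianization K),
            IsOpen (H : Set (absoluteGaloisGroupAbelianization K)) ∧ H.comap θ = N :=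
  ⟨fun hθ => ⟨hθ.continuous, hθ.denseRange, hθ.exists_isOpen_comap_eq⟩,
    fun h => IsGlobalReciprocityMap.of_denseRange₁ h.1 h.2.1 h.2.2⟩

/-- **The global reciprocity law reduces exactly to the Artin map in limit form** (`K : Type`):
the named fact `exists_isGlobalReciprocityMap K` (Neukirch III (7.12) with (6.13), (6.14), (7.8))
holds iff there is a continuous homomorphism `θ : C_K →* Γ_K^ab` with dense range such that every
open subgroup of finite index of `C_K` is `θ⁻¹(H)` for some open subgroup `H ≤ Γ_K^ab` — i.e. iff
the universal norm residue symbol exists (II (1.15): dense image) with the norm groups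
`ker ( , L|K) = θ⁻¹(G(K^ab|L))` exhausting the open subgroups of finite index ((6.13), (6.14),
(7.8)).  Surjectivity and the description of the kernel, i.e. (7.12) proper, are supplied by the
tree (`IsGlobalReciprocityMap.of_denseRange₁`); what remains open is global class field theory
proper. [cite: Neukirch2013, Part III Thm. (7.12), (6.13), (7.8)] -/
theorem exists_isGlobalReciprocityMap_iff_artinMapLimitForm :
    exists_isGlobalReciprocityMap K ↔
      ∃ θ : ideleGroup K ⧸ principalIdeles K →* absoluteGaloisGroupAbelianization K,
        Continuous θ ∧ DenseRange θ ∧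
          ∀ N : Subgroup (ideleGroup K ⧸ principalIdeles K),
            IsOpen (N : Set (ideleGroup K ⧸ principalIdeles K)) → N.FiniteIndex →
              ∃ H : Subgroup (absoluteGaloisGroupAbelianization K),
                IsOpen (H : Set (absoluteGaloisGroupAbelianization K)) ∧ H.comap θ = N :=
  ⟨fun ⟨θ, hθ⟩ => ⟨θ, (isGlobalReciprocityMap_iff_denseRange₁ θ).1 hθ⟩,
    fun ⟨θ, hθ⟩ => ⟨θ, (isGlobalReciprocityMap_iff_denseRange₁ θ).2 hθ⟩⟩

end Literature.NumberTheory.GaloisRepresentations
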